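import Summits.HodgeConjecture.HodgeConjecture.Theorems.F0P3cStCharTSStChar              -- ★ p851315 (this seat) «ST-CHAR★»: the case-(1) pair `χ_St(ψ)`, `continuous_stFst`
import Summits.HodgeConjecture.HodgeConjecture.Theorems.F0P2nFrobeniusFunctional         -- ★ (F0P2-p01 (g6)) Frobenius: `exists_intertwiningMap_cmPrincipalSeries_apply_ne_zero`, `isConstituentOf_mk_of_intertwiningMap_ne_zero`
import Summits.HodgeConjecture.HodgeConjecture.Theorems.F0P2oBorelTorusModulus            -- ★ `rootDeltaChar_cmBorel_torus_mul_unipotent` (`δ_B^{1/2}(t n) = ‖t₀₀‖`)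
import Summits.HodgeConjecture.HodgeConjecture.Theorems.F0P3U3PrincipalSeriesJacquetFiltrationHolds  -- ★ p832625 N1 hypothesis-free `U3PrincipalSeriesJacquetFiltration_holds` (`dim r_B i_G(χ) = 2`)
import Summits.HodgeConjecture.HodgeConjecture.Theorems.F0P3cStCharTSShellFn             -- ★ (LH6-p05) `isOpen_ker_of_continuous` on `E_vˣ × E¹_v`
import Literature.NumberTheory.Automorphic.SmoothCharacterOfCharacter                      -- ★ `SmoothIrrep.ofChar`, `twist_trivial_apply`
import Mathlib.Topology.Algebra.Group.Matrix
import HarnessLib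

/-!
# F0 · P3c · line LH6 «StCharTS» — «ST-ONE-DIM★»: THE ONE-DIMENSIONAL CONSTITUENT `ψ∘det_G` OF THE CASE-(1) PRINCIPAL SERIES `i_G(χ_St(ψ))` OF
# `U(Φ₃)(L⁺_v)` [Rogawski1990, §12.2 (1): «`JH(i_G(χ)) = {ψ∘det_G, St_G(ψ)}`»] — Keys' case (1)(a): `i_G(χ_St(ψ))` IS REDUCIBLE (datum road, slice S4b, file C)

Cell `pub/hodgecm-mathlib`, crux H413 = `stmt-HodgeConjecture-24833` (lane `--supports … --as helper`), route HCCMUnconditional; seat F0P2-p06 (g17).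
THEOREMS ONLY (no definition ∕ instance ∕ notation ∕ named fact ∕ `sorry`); ★-only imports.

WHAT.  For a continuous character `ψ` of `E¹_v = U(1)(L⁺_v)` (★ `normOneUnits`) the one-dimensional representation `g ↦ ψ(det g)` of
`G = U(Φ₃)(L⁺_v)` (the determinant of a unitary matrix has `σ`-norm one, §1) restricted to the Borel `B = TN` is `χ_St(ψ) ∘ proj · δ_B^{1/2}`
with `χ_St(ψ) = (‖·‖_E^{-1}, ψ)` (★ «ST-CHAR★»; `δ_B^{1/2}(d(α,β,ᾱ⁻¹)) = ‖α‖_E` ★ `rootDeltaChar_cmBorel_torus`) — the KEY identity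
`comp_det_apply_borel` (§3).  Hence, by Frobenius reciprocity (★ `exists_intertwiningMap_cmPrincipalSeries_apply_ne_zero`, the constant
function `g ↦ ψ(det g)`), there is a NON-ZERO `G`-map `ℂ_{ψ∘det} → i_G(χ_St(ψ))` (§4): the class `⟦ψ∘det⟧ = ⟦SmoothIrrep.ofChar (ψ∘det)⟧` is a
CONSTITUENT of `i_G(χ_St(ψ))` (`isConstituentOf_ofChar_stChar`) with Jacquet exponent `χ_St(ψ)` (`hasJacquetExponent_ofChar_stChar`), and its
image is a `G`-stable LINE which is neither `⊥` nor `⊤` (`⊤` has a two-dimensional Jacquet module by ★ N1 `U3PrincipalSeriesJacquetFiltration_holds`):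
**`i_G(χ_St(ψ))` IS REDUCIBLE** (`exists_subrepresentation_ne_bot_ne_top_stChar`, Keys (1)(a) in-house) — the `hred` input of the labelled-pair
package ★ `IrrClass.labelledPair_exists_of_line_abs` ∕ «ST-LABELS★».  The determinant character is built LOCALLY (§2, `exists_detNormOne`); the heads
are existential in it, so no definition is introduced.
HONEST LABEL: HC_CM is proved only modulo the 7 printed citations (2 remaining named inputs: hLiu418 = `stmt-HodgeConjecture-24832`, h413 =
`stmt-HodgeConjecture-24833`) until rung 0 closes; this file closes no organ (count-neutral datum-road brick towards (ST-L2) of (S-𝔇)).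

## References
* [Rogawski1990] J. D. Rogawski, *Automorphic Representations of Unitary Groups in Three Variables*, Ann. of Math. Stud. 123 (1990): §12.2 (1) p. 173.
* [Keys1984] D. Keys, *Principal series representations of special unitary groups over local fields*, Compositio Math. 51 (1984), §7 Theorem (1).
* [BernsteinZelevinsky1977] I. N. Bernstein, A. V. Zelevinsky, *Induced representations of reductive p-adic groups I*, Ann. Sci. ÉNS 10 (1977), §2.3,
  Prop. 2.28∕1.9 (Frobenius reciprocity).
* [Casselman1995] W. Casselman, *Introduction to the theory of admissible representations of `p`-adic reductive groups* (1995), §3.2, L. 7.1.1.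
-/

set_option autoImplicit false
-- the mandated namespace has the single-problem summit's repeated segment (`HodgeConjecture.HodgeConjecture`)
set_option linter.dupNamespace false

noncomputable section

open NumberField IsDedekindDomain MeasureTheory Topology
open scoped Matrix MatrixGroups NNReal
open Literature.NumberTheory.Automorphic Literature.NumberTheory.Automorphic.UnitaryGroup

namespace Summit.HodgeConjecture.HodgeConjecture.Cruxes.H413.F0P3cStCharTSStOneDim

variable (L : Type) [Field L] [NumberField L] [IsCMField L] (v : HeightOneSpectrum (𝓞 ↥(maximalRealSubfield L)))

/-! ## §1 The determinant of a unitary matrix of `U(Φ₃)(L⁺_v)` has `σ`-norm one; it is `1` on `N` -/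

omit [IsCMField L] in
/-- `det Φ₃` is a unit in `L ⊗ L⁺_v` (★ `cmLocalForm_eq_over`, ★ `StdForm.isUnit_over`). [cite: Rogawski1990, §1.9 p. 8] -/
theorem isUnit_det_cmLocalForm : IsUnit (cmLocalForm L 3 v).det := by
  rw [cmLocalForm_eq_over L 3 v]
  exact (Matrix.isUnit_iff_isUnit_det _).1 ((StdForm.antidiagonal 3).isUnit_over (UnitaryGroup.LocalRing L v))

/-- **`σ(det g) · det g = 1`** for `g ∈ U(Φ₃)(L⁺_v)` (determinants in `ᵗσ(g) Φ₃ g = Φ₃`). [cite: Rogawski1990, §1.9 p. 8; §12.2 (1) p. 173] -/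
theorem conjLocal_det_mul_det (g : ↥(unitaryGroupOfForm (conjLocal L (IsCMField.complexConj L) v) (cmLocalForm L 3 v))) :
    conjLocal L (IsCMField.complexConj L) v g.1.1.det * g.1.1.det = 1 := by
  have h := congrArg Matrix.det (mem_unitaryGroupOfForm_iff.1 g.2)
  rw [Matrix.det_mul, Matrix.det_mul, Matrix.det_transpose, ← RingHom.mapMatrix_apply, ← RingHom.map_det] at h
  -- `σ(det g) · det Φ₃ · det g = det Φ₃`, cancel the unit `det Φ₃`
  have h' : conjLocal L (IsCMField.complexConj L) v g.1.1.det * g.1.1.det * (cmLocalForm L 3 v).det = 1 * (cmLocalForm L 3 v).det := by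
    rw [one_mul, mul_right_comm]; exact h
  exact (isUnit_det_cmLocalForm L v).mul_right_cancel h'

/-- **`det g ∈ E¹_v`** (★ `normOneUnits`) for `g ∈ U(Φ₃)(L⁺_v)`. [cite: Rogawski1990, §1.9 p. 8; §12.2 (1) p. 173] -/
theorem det_mem_normOneUnits (g : ↥(unitaryGroupOfForm (conjLocal L (IsCMField.complexConj L) v) (cmLocalForm L 3 v))) :
    Matrix.GeneralLinearGroup.det (g : GL (Fin 3) (UnitaryGroup.LocalRing L v)) ∈ normOneUnits (conjLocal L (IsCMField.complexConj L) v) := by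
  rw [mem_normOneUnits_iff, Matrix.GeneralLinearGroup.val_det_apply]
  exact conjLocal_det_mul_det L v g

omit [IsCMField L] in
/-- `det n = 1` for `n` in the unipotent radical `N` (upper unitriangular). [cite: Rogawski1990, §1.10 p. 9] -/
theorem det_eq_one_of_mem_unipotentU {σ' : UnitaryGroup.LocalRing L v →+* UnitaryGroup.LocalRing L v} {J : Matrix (Fin 3) (Fin 3) (UnitaryGroup.LocalRing L v)}
    (n : ↥(unitaryGroupOfForm σ' J)) (hn : n ∈ unipotentU σ' J) :
    Matrix.GeneralLinearGroup.det (n : GL (Fin 3) (UnitaryGroup.LocalRing L v)) = 1 := by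
  obtain ⟨htri, hdiag⟩ := (mem_unipotentU_iff n).1 hn
  apply Units.ext
  rw [Matrix.GeneralLinearGroup.val_det_apply, Matrix.det_of_upperTriangular htri, Units.val_one]
  exact Finset.prod_eq_one fun i _ => hdiag i

/-! ## §2 The determinant character `det : U(Φ₃)(L⁺_v) →* E¹_v` (a local witness; no definition is introduced) and the open kernel of `ψ∘det` -/

/-- **There is a continuous homomorphism `d : U(Φ₃)(L⁺_v) →* E¹_v` with `d g = det g`.** [cite: Rogawski1990, §12.2 (1) p. 173] -/
theorem exists_detNormOne :
    ∃ d : ↥(unitaryGroupOfForm (conjLocal L (IsCMField.complexConj L) v) (cmLocalForm L 3 v)) →* ↥(normOneUnits (conjLocal L (IsCMField.complexConj L) v)),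
      (∀ g, ((d g : ↥(normOneUnits (conjLocal L (IsCMField.complexConj L) v))) : (UnitaryGroup.LocalRing L v)ˣ) =
          Matrix.GeneralLinearGroup.det (g : GL (Fin 3) (UnitaryGroup.LocalRing L v))) ∧
      Continuous d := by
  refine ⟨(Matrix.GeneralLinearGroup.det.comp (unitaryGroupOfForm (conjLocal L (IsCMField.complexConj L) v) (cmLocalForm L 3 v)).subtype).codRestrict
      (normOneUnits (conjLocal L (IsCMField.complexConj L) v)) (fun g => det_mem_normOneUnits L v g), fun _ => rfl, ?_⟩
  refine continuous_induced_rng.2 ?_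
  exact Matrix.GeneralLinearGroup.continuous_det.comp continuous_subtype_val

/-- **A continuous character of `E¹_v` has OPEN KERNEL** (read off ★ `isOpen_ker_of_continuous` on `E_vˣ × E¹_v` along the slice `z ↦ (1, z)`).
[cite: BushnellHenniart2006, §1.5] [cite: Rogawski1990, §12.2 p. 173] -/
theorem isOpen_ker_normOneUnits (ψ : ↥(normOneUnits (conjLocal L (IsCMField.complexConj L) v)) →* ℂˣ) (hψ : Continuous ψ) :
    IsOpen ((ψ.ker : Subgroup ↥(normOneUnits (conjLocal L (IsCMField.complexConj L) v))) : Set ↥(normOneUnits (conjLocal L (IsCMField.complexConj L) v))) := by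
  have h := F0P3cStCharTSShellFn.isOpen_ker_of_continuous L v (ψ.comp (MonoidHom.snd _ _)) (hψ.comp continuous_snd)
  have hs : Continuous fun z : ↥(normOneUnits (conjLocal L (IsCMField.complexConj L) v)) => ((1 : (UnitaryGroup.LocalRing L v)ˣ), z) :=
    continuous_const.prodMk continuous_id
  convert h.preimage hs using 1
  ext z
  simp only [Set.mem_preimage, SetLike.mem_coe, MonoidHom.mem_ker, MonoidHom.comp_apply, MonoidHom.coe_snd]

/-- **`ψ∘d` has open kernel** for a continuous `ψ : E¹_v →* ℂˣ` and a continuous `d : U(Φ₃)(L⁺_v) →* E¹_v`. [cite: BushnellHenniart2006, §1.5] -/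
theorem isOpen_ker_comp (ψ : ↥(normOneUnits (conjLocal L (IsCMField.complexConj L) v)) →* ℂˣ) (hψ : Continuous ψ)
    (d : ↥(unitaryGroupOfForm (conjLocal L (IsCMField.complexConj L) v) (cmLocalForm L 3 v)) →* ↥(normOneUnits (conjLocal L (IsCMField.complexConj L) v)))
    (hdc : Continuous d) :
    IsOpen (((ψ.comp d).ker : Subgroup ↥(unitaryGroupOfForm (conjLocal L (IsCMField.complexConj L) v) (cmLocalForm L 3 v))) :
      Set ↥(unitaryGroupOfForm (conjLocal L (IsCMField.complexConj L) v) (cmLocalForm L 3 v))) := by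
  convert (isOpen_ker_normOneUnits L v ψ hψ).preimage hdc using 1
  ext g
  simp only [SetLike.mem_coe, MonoidHom.mem_ker, MonoidHom.comp_apply, Set.mem_preimage]

/-! ## §3 The KEY identity on the Borel: `ψ(det p) = χ_St(ψ)(proj p) · δ_B^{1/2}(p)` -/

/-- **`det p = det (proj p)`** on the Borel `B = TN` (`p = (proj p) · n`, `det n = 1`), for the determinant character `d`. [cite: Rogawski1990, §1.10 p. 9] -/
theorem det_proj
    (d : ↥(unitaryGroupOfForm (conjLocal L (IsCMField.complexConj L) v) (cmLocalForm L 3 v)) →* ↥(normOneUnits (conjLocal L (IsCMField.complexConj L) v)))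
    (hd : ∀ g, ((d g : ↥(normOneUnits (conjLocal L (IsCMField.complexConj L) v))) : (UnitaryGroup.LocalRing L v)ˣ) =
      Matrix.GeneralLinearGroup.det (g : GL (Fin 3) (UnitaryGroup.LocalRing L v)))
    (p : ↥(cmBorelTriple L 3 v).P) :
    d (p : ↥(unitaryGroupOfForm (conjLocal L (IsCMField.complexConj L) v) (cmLocalForm L 3 v))) =
      d (((cmBorelTriple L 3 v).proj p : ↥(cmBorelTriple L 3 v).M) : ↥(unitaryGroupOfForm (conjLocal L (IsCMField.complexConj L) v) (cmLocalForm L 3 v))) := by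
  have hn := (cmBorelTriple L 3 v).proj_inv_mul_mem p
  have h1 : d ((((cmBorelTriple L 3 v).proj p : ↥(cmBorelTriple L 3 v).M) :
      ↥(unitaryGroupOfForm (conjLocal L (IsCMField.complexConj L) v) (cmLocalForm L 3 v)))⁻¹ *
        (p : ↥(unitaryGroupOfForm (conjLocal L (IsCMField.complexConj L) v) (cmLocalForm L 3 v)))) = 1 := by
    apply Subtype.ext
    rw [hd, OneMemClass.coe_one]
    exact det_eq_one_of_mem_unipotentU L v _ hn
  rw [map_mul, map_inv, inv_mul_eq_one] at h1
  exact h1.symm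

set_option maxHeartbeats 1600000 in
/-- **THE KEY IDENTITY: `ψ(det p) = χ_St(ψ)(proj p) · δ_B^{1/2}(p)` for `p ∈ B(L⁺_v)`** — `p = t·n` with `t = proj p = d(α, β, ᾱ⁻¹)`, `det p = det t`,
`δ_B^{1/2}(p) = ‖α‖` (★ `rootDeltaChar_cmBorel_torus_mul_unipotent`) and `χ_St(ψ)(t) = ‖α‖⁻¹ · ψ(det t)`: i.e. the one-dimensional `ψ∘det` restricted to `B`
is `χ_St(ψ)∘proj ⊗ δ_B^{1/2}` — exactly the equivariance of the constant function in `i_G(χ_St(ψ))` (normalised induction). [cite: Rogawski1990, §12.2 (1) p. 173]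
[cite: BernsteinZelevinsky1977, §2.3] -/
theorem comp_det_apply_borel (ψ : ↥(normOneUnits (conjLocal L (IsCMField.complexConj L) v)) →* ℂˣ)
    (d : ↥(unitaryGroupOfForm (conjLocal L (IsCMField.complexConj L) v) (cmLocalForm L 3 v)) →* ↥(normOneUnits (conjLocal L (IsCMField.complexConj L) v)))
    (hd : ∀ g, ((d g : ↥(normOneUnits (conjLocal L (IsCMField.complexConj L) v))) : (UnitaryGroup.LocalRing L v)ˣ) =
      Matrix.GeneralLinearGroup.det (g : GL (Fin 3) (UnitaryGroup.LocalRing L v)))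
    (p : ↥(cmBorelTriple L 3 v).P) :
    haveI := locallyCompactSpace_cmBorelU L 3 v
    ((ψ (d (p : ↥(unitaryGroupOfForm (conjLocal L (IsCMField.complexConj L) v) (cmLocalForm L 3 v)))) : ℂˣ) : ℂ) =
      ((cmTorusCharPair L v (halfModulusChar (UnitaryGroup.LocalRing L v) * halfModulusChar (UnitaryGroup.LocalRing L v))⁻¹ ψ
          ((cmBorelTriple L 3 v).proj p) : ℂˣ) : ℂ) *
        ((rootDeltaChar (cmBorelTriple L 3 v).P p : ℂˣ) : ℂ) := by
  haveI := locallyCompactSpace_cmBorelU L 3 v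
  set t : ↥(cmBorelTriple L 3 v).M := (cmBorelTriple L 3 v).proj p with ht
  -- `p = tP * nP` inside `B`, `nP ∈ N`
  set tP : ↥(cmBorelTriple L 3 v).P := Subgroup.inclusion (cmBorelTriple L 3 v).M_le t with htP
  have hdec : p = tP * (tP⁻¹ * p) := (mul_inv_cancel_left tP p).symm
  have htT : (tP : ↥(unitaryGroupOfForm (conjLocal L (IsCMField.complexConj L) v) (cmLocalForm L 3 v))) ∈
      torusU (conjLocal L (IsCMField.complexConj L) v) (cmLocalForm L 3 v) := t.2
  have hnN : ((tP⁻¹ * p : ↥(cmBorelTriple L 3 v).P) : ↥(unitaryGroupOfForm (conjLocal L (IsCMField.complexConj L) v) (cmLocalForm L 3 v))) ∈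
      (cmBorelTriple L 3 v).N := (cmBorelTriple L 3 v).proj_inv_mul_mem p
  -- `δ_B^{1/2}(p) = ‖α‖`
  have hδ : ((rootDeltaChar (cmBorelTriple L 3 v).P p : ℂˣ) : ℂ) =
      ((unitModulusChar (UnitaryGroup.LocalRing L v) (torusEntry (conjLocal L (IsCMField.complexConj L) v) (cmLocalForm L 3 v) 0 t) : ℝ≥0) : ℝ) := by
    have h := F0P2oBorelTorusModulus.rootDeltaChar_cmBorel_torus_mul_unipotent L v tP (tP⁻¹ * p) htT hnN
    rw [← hdec] at h
    exact h
  -- `det p = det t` in `E¹_v`, and `d t = torusDetNormOne t`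
  have hdet : d (p : ↥(unitaryGroupOfForm (conjLocal L (IsCMField.complexConj L) v) (cmLocalForm L 3 v))) =
      torusDetNormOne (conjLocal L (IsCMField.complexConj L) v) (cmLocalForm L 3 v) (cmLocalForm_eq_over L 3 v) t := by
    rw [det_proj L v d hd p]
    apply Subtype.ext
    apply Units.ext
    rw [hd, Matrix.GeneralLinearGroup.val_det_apply, coe_torusDetNormOne, coe_torusDet]
  -- the value of `χ_St(ψ)` at `t`
  have hpos : (((unitModulusChar (UnitaryGroup.LocalRing L v) (torusEntry (conjLocal L (IsCMField.complexConj L) v) (cmLocalForm L 3 v) 0 t) : ℝ≥0) : ℝ) : ℂ) ≠ 0 := by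
    rw [Complex.ofReal_ne_zero]
    exact (NNReal.coe_pos.2 (distribHaarChar_pos (A := UnitaryGroup.LocalRing L v) (g := _))).ne'
  have hval : ((cmTorusCharPair L v (halfModulusChar (UnitaryGroup.LocalRing L v) * halfModulusChar (UnitaryGroup.LocalRing L v))⁻¹ ψ t : ℂˣ) : ℂ) =
      ((((unitModulusChar (UnitaryGroup.LocalRing L v) (torusEntry (conjLocal L (IsCMField.complexConj L) v) (cmLocalForm L 3 v) 0 t) : ℝ≥0) : ℝ) : ℂ))⁻¹ *
        ((ψ (torusDetNormOne (conjLocal L (IsCMField.complexConj L) v) (cmLocalForm L 3 v) (cmLocalForm_eq_over L 3 v) t) : ℂˣ) : ℂ) := by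
    rw [F0P3cStCharTSStChar.stChar_apply, Units.val_mul, Units.val_inv_eq_inv_val, Units.val_mul, ← sq, halfModulusChar_sq]
  rw [hdet, hval, hδ, mul_assoc, mul_comm ((ψ _ : ℂˣ) : ℂ), ← mul_assoc, inv_mul_cancel₀ hpos, one_mul]

/-! ## §4 Frobenius: the one-dimensional `ψ∘det` is a constituent of `i_G(χ_St(ψ))`, with Jacquet exponent `χ_St(ψ)` -/

set_option maxHeartbeats 1600000 in
/-- **A NON-ZERO `G`-map `ℂ_{ψ∘det} → i_G(χ_St(ψ))`** (Frobenius reciprocity for the identity functional on `ℂ`, ★ `exists_intertwiningMap_cmPrincipalSeries_apply_ne_zero`,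
fed with the KEY identity of §3): `Φ 1 ≠ 0`, `(Φ z)(g) = ψ(det g) · z`. [cite: BernsteinZelevinsky1977, §2.3] [cite: Rogawski1990, §12.2 (1) p. 173] -/
theorem exists_intertwiningMap_ofChar_stChar (ψ : ↥(normOneUnits (conjLocal L (IsCMField.complexConj L) v)) →* ℂˣ)
    (d : ↥(unitaryGroupOfForm (conjLocal L (IsCMField.complexConj L) v) (cmLocalForm L 3 v)) →* ↥(normOneUnits (conjLocal L (IsCMField.complexConj L) v)))
    (hd : ∀ g, ((d g : ↥(normOneUnits (conjLocal L (IsCMField.complexConj L) v))) : (UnitaryGroup.LocalRing L v)ˣ) =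
      Matrix.GeneralLinearGroup.det (g : GL (Fin 3) (UnitaryGroup.LocalRing L v)))
    (hξ : IsOpen (((ψ.comp d).ker : Subgroup ↥(unitaryGroupOfForm (conjLocal L (IsCMField.complexConj L) v) (cmLocalForm L 3 v))) :
      Set ↥(unitaryGroupOfForm (conjLocal L (IsCMField.complexConj L) v) (cmLocalForm L 3 v)))) :
    ∃ Φ : ((Representation.trivial ℂ ↥(unitaryGroupOfForm (conjLocal L (IsCMField.complexConj L) v) (cmLocalForm L 3 v)) ℂ).twist (ψ.comp d)).IntertwiningMap
        (cmPrincipalSeries L 3 v (cmTorusCharPair L v (halfModulusChar (UnitaryGroup.LocalRing L v) * halfModulusChar (UnitaryGroup.LocalRing L v))⁻¹ ψ)),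
      Φ (1 : ℂ) ≠ 0 := by
  obtain ⟨Φ, hΦ, -⟩ := F0P2nFrobeniusFunctional.exists_intertwiningMap_cmPrincipalSeries_apply_ne_zero L 3 v
    (cmTorusCharPair L v (halfModulusChar (UnitaryGroup.LocalRing L v) * halfModulusChar (UnitaryGroup.LocalRing L v))⁻¹ ψ)
    ((Representation.trivial ℂ ↥(unitaryGroupOfForm (conjLocal L (IsCMField.complexConj L) v) (cmLocalForm L 3 v)) ℂ).twist (ψ.comp d))
    (isSmooth_trivial_twist hξ) (LinearMap.id : ℂ →ₗ[ℂ] ℂ)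
    (fun p w => by
      rw [LinearMap.id_apply, LinearMap.id_apply, twist_trivial_apply, MonoidHom.comp_apply, comp_det_apply_borel L v ψ d hd p])
    (1 : ℂ) (by rw [LinearMap.id_apply]; exact one_ne_zero)
  exact ⟨Φ, hΦ⟩

set_option maxHeartbeats 1600000 in
/-- **`⟦ψ∘det⟧` IS A CONSTITUENT OF `i_G(χ_St(ψ))`** (Keys (1): the one-dimensional member of `JH(i_G(χ))`; ★ `isConstituentOf_mk_of_intertwiningMap_ne_zero` on §4's map).
[cite: Rogawski1990, §12.2 (1) p. 173] [cite: Keys1984, §7 Theorem (1)] -/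
theorem isConstituentOf_ofChar_stChar (ψ : ↥(normOneUnits (conjLocal L (IsCMField.complexConj L) v)) →* ℂˣ)
    (d : ↥(unitaryGroupOfForm (conjLocal L (IsCMField.complexConj L) v) (cmLocalForm L 3 v)) →* ↥(normOneUnits (conjLocal L (IsCMField.complexConj L) v)))
    (hd : ∀ g, ((d g : ↥(normOneUnits (conjLocal L (IsCMField.complexConj L) v))) : (UnitaryGroup.LocalRing L v)ˣ) =
      Matrix.GeneralLinearGroup.det (g : GL (Fin 3) (UnitaryGroup.LocalRing L v)))
    (hξ : IsOpen (((ψ.comp d).ker : Subgroup ↥(unitaryGroupOfForm (conjLocal L (IsCMField.complexConj L) v) (cmLocalForm L 3 v))) :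
      Set ↥(unitaryGroupOfForm (conjLocal L (IsCMField.complexConj L) v) (cmLocalForm L 3 v)))) :
    (IrrClass.mk (SmoothIrrep.ofChar (ψ.comp d) hξ)).IsConstituentOf
      (cmPrincipalSeries L 3 v (cmTorusCharPair L v (halfModulusChar (UnitaryGroup.LocalRing L v) * halfModulusChar (UnitaryGroup.LocalRing L v))⁻¹ ψ)) := by
  obtain ⟨Φ, hΦ⟩ := exists_intertwiningMap_ofChar_stChar L v ψ d hd hξ
  have hΦ0 : Φ ≠ 0 := fun h => hΦ (by rw [h]; rfl)
  exact F0P2nFrobeniusFunctional.isConstituentOf_mk_of_intertwiningMap_ne_zero (isIrreducible_trivial_twist (ψ.comp d))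
    (isSmooth_trivial_twist hξ) Φ hΦ0

/-- **GENERIC: the Jacquet exponent of a character representation.**  For a parabolic triple `(P, M, N)` of `G` and a character `ξ` of `G` trivial on `N` whose
restriction to `M` is `χ · δ_P^{1/2}`, the one-dimensional representation `ℂ_ξ` has `χ` as a (normalised) Jacquet exponent: `N` acts trivially, so `[1] ≠ 0` in the
coinvariants (the identity functional descends), and `r(ℂ_ξ)(m)[1] = δ_P^{-1/2}(m) ξ(m) [1] = χ(m) [1]`. [cite: Casselman1995, §3.2 p. 37; §4.4 p. 45]
[cite: BernsteinZelevinsky1977, §2.3] -/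
theorem hasJacquetExponent_twist_trivial_of_character {G : Type*} [Group G] [TopologicalSpace G] [IsTopologicalGroup G]
    (t : ParabolicTriple G) [LocallyCompactSpace ↥t.P] (ξ : G →* ℂˣ) (χ : ↥t.M →* ℂˣ)
    (hN : ∀ n : ↥t.P, (n : G) ∈ t.N → ξ (n : G) = 1)
    (hχ : ∀ m : ↥t.M, ((ξ (m : G) : ℂˣ) : ℂ) = ((χ m : ℂˣ) : ℂ) * ((rootDeltaChar t.P (Subgroup.inclusion t.M_le m) : ℂˣ) : ℂ)) :
    ((Representation.trivial ℂ G ℂ).twist ξ).HasJacquetExponent t χ := by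
  -- `N` acts trivially on `ℂ_ξ`: the identity functional descends to the coinvariants
  have htriv : ∀ n : ↥(t.N.subgroupOf t.P),
      (LinearMap.id : ℂ →ₗ[ℂ] ℂ) ∘ₗ t.restrict ((Representation.trivial ℂ G ℂ).twist ξ) n = LinearMap.id := by
    intro n
    apply LinearMap.ext
    intro z
    show ((Representation.trivial ℂ G ℂ).twist ξ) ((n : ↥t.P) : G) z = z
    rw [twist_trivial_apply, hN _ (Subgroup.mem_subgroupOf.1 n.2), Units.val_one, one_mul]
  refine ⟨Representation.Coinvariants.mk (t.restrict ((Representation.trivial ℂ G ℂ).twist ξ)) (1 : ℂ), fun h0 => ?_, fun m => ?_⟩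
  · -- `[1] ≠ 0`: evaluate the descended identity functional
    have h := Representation.Coinvariants.lift_mk (t.restrict ((Representation.trivial ℂ G ℂ).twist ξ)) LinearMap.id htriv (1 : ℂ)
    rw [h0, map_zero, LinearMap.id_apply] at h
    exact one_ne_zero h.symm
  · -- the action of `m`: `δ^{-1/2}(m) • [ξ(m)] = χ(m) • [1]`
    have hsm : Representation.Coinvariants.mk (t.restrict ((Representation.trivial ℂ G ℂ).twist ξ)) (((ξ (m : G) : ℂˣ) : ℂ)) =
        (((ξ (m : G) : ℂˣ) : ℂ)) • Representation.Coinvariants.mk (t.restrict ((Representation.trivial ℂ G ℂ).twist ξ)) (1 : ℂ) := by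
      have h := LinearMap.map_smul (Representation.Coinvariants.mk (t.restrict ((Representation.trivial ℂ G ℂ).twist ξ))) (((ξ (m : G) : ℂˣ) : ℂ)) (1 : ℂ)
      rw [smul_eq_mul, mul_one] at h
      exact h
    have hδ0 : ((rootDeltaChar t.P (Subgroup.inclusion t.M_le m) : ℂˣ) : ℂ) ≠ 0 := Units.ne_zero _
    have key : ((ξ (m : G) : ℂˣ) : ℂ) = ((rootDeltaChar t.P (Subgroup.inclusion t.M_le m) : ℂˣ) : ℂ) * ((χ m : ℂˣ) : ℂ) := (hχ m).trans (mul_comm _ _)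
    rw [Representation.normalizedJacquet_mk, twist_trivial_apply, mul_one, hsm, smul_smul]
    congr 1
    rw [Units.val_inv_eq_inv_val, key]
    exact inv_mul_cancel_left₀ hδ0 _

set_option maxHeartbeats 1600000 in
/-- **The Jacquet exponent of `ψ∘det` is `χ_St(ψ)`** (the generic lemma at the Borel triple of `U(Φ₃)(L⁺_v)`: `det n = 1` on `N`, the KEY identity on `T`).
[cite: Casselman1995, §3.2 p. 37; §4.4 p. 45] [cite: Rogawski1990, §12.2 (1) p. 173] -/
theorem hasJacquetExponent_ofChar_stChar (ψ : ↥(normOneUnits (conjLocal L (IsCMField.complexConj L) v)) →* ℂˣ)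
    (d : ↥(unitaryGroupOfForm (conjLocal L (IsCMField.complexConj L) v) (cmLocalForm L 3 v)) →* ↥(normOneUnits (conjLocal L (IsCMField.complexConj L) v)))
    (hd : ∀ g, ((d g : ↥(normOneUnits (conjLocal L (IsCMField.complexConj L) v))) : (UnitaryGroup.LocalRing L v)ˣ) =
      Matrix.GeneralLinearGroup.det (g : GL (Fin 3) (UnitaryGroup.LocalRing L v))) :
    haveI := locallyCompactSpace_cmBorelU L 3 v
    ((Representation.trivial ℂ ↥(unitaryGroupOfForm (conjLocal L (IsCMField.complexConj L) v) (cmLocalForm L 3 v)) ℂ).twist (ψ.comp d)).HasJacquetExponent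
      (cmBorelTriple L 3 v) (cmTorusCharPair L v (halfModulusChar (UnitaryGroup.LocalRing L v) * halfModulusChar (UnitaryGroup.LocalRing L v))⁻¹ ψ) := by
  haveI := locallyCompactSpace_cmBorelU L 3 v
  refine hasJacquetExponent_twist_trivial_of_character (cmBorelTriple L 3 v) (ψ.comp d) _ (fun n hn => ?_) (fun m => ?_)
  · -- `ψ(det n) = 1`
    have hn1 : d (n : ↥(unitaryGroupOfForm (conjLocal L (IsCMField.complexConj L) v) (cmLocalForm L 3 v))) = 1 := by
      apply Subtype.ext
      rw [hd, OneMemClass.coe_one]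
      exact det_eq_one_of_mem_unipotentU L v _ hn
    rw [MonoidHom.comp_apply, hn1, map_one]
  · -- the KEY identity at `p = m` (`proj m = m`)
    have key := comp_det_apply_borel L v ψ d hd (Subgroup.inclusion (cmBorelTriple L 3 v).M_le m)
    have hproj : (cmBorelTriple L 3 v).proj (Subgroup.inclusion (cmBorelTriple L 3 v).M_le m) = m :=
      Subtype.ext ((cmBorelTriple L 3 v).proj_apply_of_mem_M _ m.2)
    rw [hproj] at key
    exact key

/-! ## §5 Keys (1)(a): `i_G(χ_St(ψ))` is REDUCIBLE -/

/-- **GENERIC: the image of a non-zero `G`-map out of `ℂ_ξ` is a `G`-stable LINE which is neither `⊥` nor `⊤` as soon as the target has a Jacquet module of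
dimension `≥ 2`** (the coinvariants of a space spanned by one vector have dimension `≤ 1`). [cite: Casselman1995, L. 7.1.1 (a) p. 67]
[cite: BernsteinZelevinsky1977, §2.3] -/
theorem exists_subrepresentation_ne_bot_ne_top_of_intertwiningMap {G : Type*} [Group G] (t : ParabolicTriple G)
    {V : Type*} [AddCommGroup V] [Module ℂ V] (ρ : Representation ℂ G V) {π : Representation ℂ G ℂ} (Φ : π.IntertwiningMap ρ) (hΦ : Φ (1 : ℂ) ≠ 0)
    (h2 : 2 ≤ Module.finrank ℂ (t.restrict ρ).Coinvariants) :
    ∃ N : Subrepresentation ρ, N ≠ ⊥ ∧ N ≠ ⊤ := by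
  refine ⟨Φ.range, fun hbot => ?_, fun htop => ?_⟩
  · -- `N = ⊥` contradicts `Φ 1 ≠ 0`
    have h1 : Φ (1 : ℂ) ∈ (LinearMap.range Φ.toLinearMap) := LinearMap.mem_range.2 ⟨1, rfl⟩
    have hb : LinearMap.range Φ.toLinearMap = (⊥ : Submodule ℂ V) := by
      rw [← Representation.IntertwiningMap.range_toSubmodule, hbot]; rfl
    rw [hb, Submodule.mem_bot] at h1
    exact hΦ h1
  · -- `N = ⊤`: `V` is spanned by `Φ 1`, so `dim V_N ≤ dim V ≤ 1`
    have ht : LinearMap.range Φ.toLinearMap = (⊤ : Submodule ℂ V) := by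
      rw [← Representation.IntertwiningMap.range_toSubmodule, htop]; rfl
    have hsurj : Function.Surjective Φ.toLinearMap := LinearMap.range_eq_top.1 ht
    haveI : Module.Finite ℂ V := Module.Finite.of_surjective Φ.toLinearMap hsurj
    have hV1 : Module.finrank ℂ V ≤ 1 := finrank_le_one (Φ (1 : ℂ)) fun w => by
      obtain ⟨z, hz⟩ := hsurj w
      refine ⟨z, ?_⟩
      rw [← hz]
      show z • Φ.toLinearMap (1 : ℂ) = Φ.toLinearMap z
      rw [← LinearMap.map_smul Φ.toLinearMap z (1 : ℂ), smul_eq_mul, mul_one]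
    have hq : Module.finrank ℂ (t.restrict ρ).Coinvariants ≤ Module.finrank ℂ V :=
      Submodule.finrank_quotient_le (Representation.Coinvariants.ker (t.restrict ρ))
    exact Nat.not_succ_le_self 1 ((h2.trans hq).trans hV1)

set_option synthInstance.maxHeartbeats 400000 in
set_option maxHeartbeats 10000000 in  -- destructuring ★ N1's conclusion at this pair (definitional bookkeeping of the CM carrier; cf. ★ `F0P3cStCharTSLdsFields` 8·10⁶, ★ `F0P3KeysLabelledPair`)
/-- **`i_G(χ_St(ψ))` HAS A `G`-STABLE SUBSPACE `N` WITH `N ≠ ⊥`, `N ≠ ⊤`** (given the determinant character `d`): the image of §4's non-zero `G`-map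
`ℂ_{ψ∘det} → i_G(χ_St(ψ))` — a `G`-stable line — against the TWO-dimensional normalised Jacquet module of `i_G(χ_St(ψ))` (★ N1
`U3PrincipalSeriesJacquetFiltration_holds`).  Keys' case (1)(a), in-house. [cite: Keys1984, §7 Theorem (1)] [cite: Rogawski1990, §12.2 (1) p. 173]
[cite: Casselman1995, L. 7.1.1 (a)] -/
theorem exists_subrepresentation_ne_bot_ne_top_of_detNormOne (hns : ∀ w : PlacesOver L v, IsCMField.complexConj L • w.1 = w.1)
    (ψ : ↥(normOneUnits (conjLocal L (IsCMField.complexConj L) v)) →* ℂˣ) (hψ : Continuous ψ)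
    (d : ↥(unitaryGroupOfForm (conjLocal L (IsCMField.complexConj L) v) (cmLocalForm L 3 v)) →* ↥(normOneUnits (conjLocal L (IsCMField.complexConj L) v)))
    (hd : ∀ g, ((d g : ↥(normOneUnits (conjLocal L (IsCMField.complexConj L) v))) : (UnitaryGroup.LocalRing L v)ˣ) =
      Matrix.GeneralLinearGroup.det (g : GL (Fin 3) (UnitaryGroup.LocalRing L v)))
    (hξ : IsOpen (((ψ.comp d).ker : Subgroup ↥(unitaryGroupOfForm (conjLocal L (IsCMField.complexConj L) v) (cmLocalForm L 3 v))) :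
      Set ↥(unitaryGroupOfForm (conjLocal L (IsCMField.complexConj L) v) (cmLocalForm L 3 v)))) :
    ∃ N : Subrepresentation
        (cmPrincipalSeries L 3 v (cmTorusCharPair L v (halfModulusChar (UnitaryGroup.LocalRing L v) * halfModulusChar (UnitaryGroup.LocalRing L v))⁻¹ ψ)),
      N ≠ ⊥ ∧ N ≠ ⊤ := by
  haveI := locallyCompactSpace_cmBorelU L 3 v
  obtain ⟨Φ, hΦ⟩ := exists_intertwiningMap_ofChar_stChar L v ψ d hd hξ
  obtain ⟨-, hrank, -⟩ := F0P3U3PrincipalSeriesJacquetFiltrationHolds.U3PrincipalSeriesJacquetFiltration_holds L v hns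
    (halfModulusChar (UnitaryGroup.LocalRing L v) * halfModulusChar (UnitaryGroup.LocalRing L v))⁻¹ ψ
    (F0P3cStCharTSStChar.continuous_stFst L v) (Units.continuous_val.comp hψ)
  exact exists_subrepresentation_ne_bot_ne_top_of_intertwiningMap (cmBorelTriple L 3 v) _ Φ hΦ hrank.symm.le

/-! ## §6 The heads (the determinant character hidden in an existential: no definition is introduced) -/

set_option maxHeartbeats 1600000 in
/-- **KEYS' CASE (1)(a), IN-HOUSE: the case-(1) principal series `i_G(χ_St(ψ)) = i_G(‖·‖⁻¹, ψ)` of `U(Φ₃)(L⁺_v)` is REDUCIBLE** (non-split `v`, `ψ` a continuous character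
of `E¹_v`): `∃ N` `G`-stable, `N ≠ ⊥`, `N ≠ ⊤` — the shape of ★ `Rogawski1990.KeysCaseTwoReducible`'s conclusion, here PROVED (the one-dimensional `ψ∘det` sits inside).
[cite: Keys1984, §7 Theorem (1)] [cite: Rogawski1990, §12.2 (1) p. 173] -/
theorem exists_subrepresentation_ne_bot_ne_top_stChar (hns : ∀ w : PlacesOver L v, IsCMField.complexConj L • w.1 = w.1)
    (ψ : ↥(normOneUnits (conjLocal L (IsCMField.complexConj L) v)) →* ℂˣ) (hψ : Continuous ψ) :
    ∃ N : Subrepresentation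
        (cmPrincipalSeries L 3 v (cmTorusCharPair L v (halfModulusChar (UnitaryGroup.LocalRing L v) * halfModulusChar (UnitaryGroup.LocalRing L v))⁻¹ ψ)),
      N ≠ ⊥ ∧ N ≠ ⊤ := by
  obtain ⟨d, hd, hdc⟩ := exists_detNormOne L v
  exact exists_subrepresentation_ne_bot_ne_top_of_detNormOne L v hns ψ hψ d hd (isOpen_ker_comp L v ψ hψ d hdc)

set_option maxHeartbeats 1600000 in
/-- **THE ONE-DIMENSIONAL CONSTITUENT OF `i_G(χ_St(ψ))` AND ITS EXPONENT** (non-split `v`): there is a character `ξ` of `U(Φ₃)(L⁺_v)` with open kernel (`ξ = ψ∘det`) such that the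
one-dimensional class `⟦ξ⟧ = ⟦SmoothIrrep.ofChar ξ⟧` is a CONSTITUENT of `i_G(χ_St(ψ))` and has Jacquet exponent `χ_St(ψ)` — the label «`ψ∘det_G ∈ JH(i_G(χ))`» of
[Rogawski1990, §12.2 (1)] with the exponent that ★ G5 `HasJacquetExponent.eq_of_equiv_twist_trivial` uses to tell it apart from `St_G(ψ)` (exponent `wχ_St(ψ)`).
[cite: Rogawski1990, §12.2 (1) p. 173] [cite: Keys1984, §7 Theorem (1)] [cite: Casselman1995, §4.4 p. 45] -/
theorem exists_ofChar_isConstituentOf_stChar (ψ : ↥(normOneUnits (conjLocal L (IsCMField.complexConj L) v)) →* ℂˣ) (hψ : Continuous ψ) :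
    ∃ (ξ : ↥(unitaryGroupOfForm (conjLocal L (IsCMField.complexConj L) v) (cmLocalForm L 3 v)) →* ℂˣ)
      (hξ : IsOpen ((ξ.ker : Subgroup ↥(unitaryGroupOfForm (conjLocal L (IsCMField.complexConj L) v) (cmLocalForm L 3 v))) :
        Set ↥(unitaryGroupOfForm (conjLocal L (IsCMField.complexConj L) v) (cmLocalForm L 3 v)))),
      (IrrClass.mk (SmoothIrrep.ofChar ξ hξ)).IsConstituentOf
          (cmPrincipalSeries L 3 v (cmTorusCharPair L v (halfModulusChar (UnitaryGroup.LocalRing L v) * halfModulusChar (UnitaryGroup.LocalRing L v))⁻¹ ψ)) ∧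
        (haveI := locallyCompactSpace_cmBorelU L 3 v
         (SmoothIrrep.ofChar ξ hξ).ρ.HasJacquetExponent (cmBorelTriple L 3 v)
          (cmTorusCharPair L v (halfModulusChar (UnitaryGroup.LocalRing L v) * halfModulusChar (UnitaryGroup.LocalRing L v))⁻¹ ψ)) := by
  obtain ⟨d, hd, hdc⟩ := exists_detNormOne L v
  exact ⟨ψ.comp d, isOpen_ker_comp L v ψ hψ d hdc, isConstituentOf_ofChar_stChar L v ψ d hd _, hasJacquetExponent_ofChar_stChar L v ψ d hd⟩

end Summit.HodgeConjecture.HodgeConjecture.Cruxes.H413.F0P3cStCharTSStOneDim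

end
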